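import Summits.ResolutionOfSingularities.ResolutionOfSingularities.Theorems.PerronRepresentations
import Summits.ResolutionOfSingularities.ResolutionOfSingularities.Theorems.KaplanskyLadderDefectless
import HarnessLib

/-!
# PerronAscent — decomp-res node «PerronLadder» (lens-1 g17 KaplanskyLadder → g18 PerronLadder), tree file
10/11 of the node

Content VERBATIM from the decomp-res lens-1 g18 file `HOME/decomp-res-lens-1/g18/PerronLadder.lean` (sha256
8bb02ceefe11b749, 3725 l; it SUPERSEDES
g17 `KaplanskyLadder.lean` fb35e2e5 ⊇ g16 `ToricLadder.lean` 67376591 as landing source; PARTS I–III = the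
landed `Theorems/ToricLadderCells`,
`ToricLadderKernels`, `ToricLadderLinks`, `ToricLadderDense`, `ToricLadder` — not repeated).  HOME =
run/shared/lean/pub/decomp-res.  Critic:
CRITIC-LEDGER rows 131 (g17, 2026-08-30T18:47:14Z) and 138 (g18 CLEARED, landing order 2026-08-30T20:05:14Z); the
lens's WRITER.md (endorsed).
Landed by decomp-res writer g7 as SUPPORT of the Valuative route item 0641 `LuAlphaPTorsor` (helper files; no
Valuative route edit is made by the
decomp-res cell: the support ports Σ₁ `MonoidalStep` / Π₁ `KK05NCVAscent`, the retirement of g16's all-rank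
`ToricAscent 3` in favour of the theorem
`toricAscentRk1_three`, and the UNCHANGED located residual `NonKHToricArchLU 3 3 4` / port-free `NonKHArchLU 3 4`
stay documented tree definitions
for the Valuative tenure / operator to book).

PART V-G (g18 NEW) §23 the port Π₁ `KK05NCVAscent : Prop` (Knaf–Kuhlmann 2005 Thm 4.1 for `τ = 0` under
(NC)+(V); support-item shaped,
NOT an item here) and the rank-one toric ascent `toricAscent_core` (KERNEL modulo CJS-2020 + Σ₁ + Π₁).

[WRITER NOTE (decomp-res writer g7): namespaces `…Theses.PerronLadder` ↦ `…Theorems.KaplanskyLadder` (PART IV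
= g17 §14–§16, files
`KaplanskyLadder`, `KaplanskyLadderDefectless`) and ↦ `…Theorems.PerronLadder` (PART V, files `PerronMerge`
§17, `PerronCharts` §18–§19,
`PerronMonomialization` §20, `PerronInitialChartPrelim` + `PerronInitialChart` §21 (400-line limit),
`PerronRepresentations` §22, `PerronAscent`
§23, `PerronLadder` §24; PART IV likewise `KaplanskyHensel` §14 / `KaplanskyLadder` §15), with `open
…Theorems.ToricLadder` (+ `…KaplanskyLadder`) so the lens's unqualified references stay verbatim; `section PartV` and its
section-scoped `open`s re-opened per file; the g16 helper `intermediateField_top_fg` is the landed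
`PfaffLine.intermediateField_top_fg_of_isFractionRing`
(renamed at its use, as in the landed `ToricLadder`); global `set_option` lines dropped; nothing else changed.]

(Sources: CossartPiltant2019; CossartJannsenSaito2020; KnafKuhlmann2005 arXiv:math/0304159 §4 Thm 4.1, Lemmas
4.2–4.4; KnafKuhlmann2009 arXiv:math/0702856 Prop 3.11, Thm 1.5; Kaplansky1942 Lemma 5, Thm 3; Kuhlmann2010 Thm
2.14; Zariski1940 §B; Cutkosky arXiv:1404.7459 §2.1; ZariskiSamuelII.)
-/

noncomputable section

open IsLocalRing Literature.AlgebraicGeometry.Resolution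
open Summit.ResolutionOfSingularities.ResolutionOfSingularities.Theses
open Summit.ResolutionOfSingularities.ResolutionOfSingularities.Theorems
open Summit.ResolutionOfSingularities.ResolutionOfSingularities.Theorems.PfaffLine
open Summit.ResolutionOfSingularities.ResolutionOfSingularities.Theorems.ToricLadder
open Summit.ResolutionOfSingularities.ResolutionOfSingularities.Theorems.KaplanskyLadder

namespace Summit.ResolutionOfSingularities.ResolutionOfSingularities.Theorems.PerronLadder

section PartV

open Finset
open CategoryTheory CategoryTheory.Limits AlgebraicGeometry TopologicalSpace
open Scheme.IdealSheafData
open scoped Classical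

/-! ## 23. PART V-G · PORT Π₁ (KK05 Thm. 4.1 for `τ = 0`) and the rank-one toric ascent -/

/-- **PORT Π₁ · Knaf–Kuhlmann 2005 Theorem 4.1 with `τ = 0`, typed exactly** (arXiv:math/0304159,
p. 9 L96–L112; hypotheses (T) p. 9 L1–L20, (NC) and (V) p. 9 L59–L92; proof pp. 10–11).  In the words of
the source: let `(F | K, P) = (F₁(x) | F₁, v)` be a valued rational function field satisfying (T)
(`IsValIndepOver O F₁ x`: the values of the `x i` are rationally independent over `vF₁`; then
`vF = vF₁ ⊕ ⨁ ℤ v(x i)` and `FP = F₁P`, Bourbaki AC VI §10.3); let `R = S ⊆ F₁` be a universally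
catenary (here: essentially of finite type over the field `k`, conjunct 6 of `RegChart`) regular local
ring dominated by `𝒪_P` (`RegChart O F₁ S`), and `Z ⊂ 𝒪_P` a finite set such that `(R, Z)` fulfils
(NC) — every `ζ ∈ Z` is `P(x)/Q(x)` whose coefficients are `R`-monomials `u · ∏ tᵢ^{εᵢ}` in a regular
parameter system (here: at `R` itself, an iterated monoidal transform of length `0`, in the parameter
family `t`, `IsParamFamily O S t`, `IsMonomialIn O S t`) — and (V) — the values of the non-unit
parameters are rationally independent (`ValIndepFamily O t`).  THEN (Thm. 4.1 and its "In particular":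
an iterated monoidal transform `R'` and `A := R'[x'…]`, `A_q` regular, `Z ⊂ A_q`, an `R`-model of `F`
on which `P` is centred in a regular point containing `Z`) — typed, as for `ToricAscent`, as a finitely
generated `k`-subalgebra `B ⊆ 𝒪_P ∩ F₁(x)` containing `Z` with `Frac B = F₁(x)` whose local ring at the
centre of `v` is regular (`B := C'[x'][Z]` for the finite presentation `C'` of `R'`; routine).
Characteristic-free; no rank hypothesis (as in the source). -/
def KK05NCVAscent : Prop :=
  ∀ (k K : Type) [Field k] [Field K] [Algebra k K] (O : ValuationSubring K),
    (∀ c : k, algebraMap k K c ∈ O) →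
    ∀ (F₁ : IntermediateField k K) (S : Subalgebra k K), RegChart O F₁ S →
    ∀ (m : ℕ) (t : Fin m → K), IsParamFamily O S t → ValIndepFamily O t →
    ∀ (ρ : ℕ) (x : Fin ρ → K), IsValIndepOver O F₁ x →
    ∀ Z : Finset K, (∀ z ∈ Z, z ∈ O) →
      (∀ z ∈ Z, ∃ P Q : MvPolynomial (Fin ρ) K,
        (∀ e ∈ P.support, IsMonomialIn O S t (P.coeff e)) ∧
        (∀ e ∈ Q.support, IsMonomialIn O S t (Q.coeff e)) ∧
        MvPolynomial.eval x Q ≠ 0 ∧ z * MvPolynomial.eval x Q = MvPolynomial.eval x P) →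
      ∃ (B : Subalgebra k K) (hB : B.toSubring ≤ O.toSubring),
        (B : Set K) ⊆ (toricField F₁ x).toSubfield ∧ (Z : Set K) ⊆ B ∧ B.FG ∧
        (∀ y ∈ (toricField F₁ x).toSubfield, ∃ a ∈ B, ∃ b ∈ B, y = a / b) ∧
        IsRegularLocalRing
          (Localization.AtPrime (Ideal.comap (Subring.inclusion hB) (IsLocalRing.maximalIdeal O)))

section Core

variable {k : Type} [Field k] {K : Type} [Field K] [Algebra k K]

/-- **THE KERNEL COMPOSITION of PART V.**  Toric ascent over a base `F₁` of transcendence degree `≤ 3`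
carrying a regular affine model `B₀` of `O ∩ F₁` (the output of `regularBase_of_relLU`), from the
named fact CJS-2020 and the two printed engines Σ₁ (`MonoidalStep`) and Π₁ (`KK05NCVAscent`):
representations (K1') → initial chart making all coefficients monomials (CJS, `exists_initial_chart`)
→ Perron–Zariski upgrade to (V) by at most `3`-parameter merging (`valIndep_upgrade`, Lemma M) →
KK05 Thm. 4.1. [folklore] -/
theorem toricAscent_core (hCJS : CossartJannsenSaito2020Embedded.{0}) (hStep : MonoidalStep)
    (hAsc : KK05NCVAscent) (O : ValuationSubring K) [hr : O.valuation.RankOne]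
    (hk : ∀ c : k, algebraMap k K c ∈ O)
    (F₁ : IntermediateField k K) (htr : Algebra.trdeg k F₁ ≤ 3)
    (B₀ : Subalgebra k K) (hB₀O : B₀.toSubring ≤ O.toSubring)
    (hB₀F : (B₀ : Set K) ⊆ F₁.toSubfield) (hB₀fg : B₀.FG)
    (hfrac : ∀ y ∈ F₁.toSubfield, ∃ a ∈ B₀, ∃ b ∈ B₀, y = a / b)
    (hreg : IsRegularLocalRing
      (Localization.AtPrime (Ideal.comap (Subring.inclusion hB₀O) (maximalIdeal O))))
    {ρ : ℕ} (x : Fin ρ → K) (hx : IsValIndepOver O F₁ x) (Z : Finset K)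
    (hZ : ∀ z ∈ Z, z ∈ O ∧ z ∈ (toricField F₁ x).toSubfield) :
    ∃ (B : Subalgebra k K) (hB : B.toSubring ≤ O.toSubring),
      (B : Set K) ⊆ (toricField F₁ x).toSubfield ∧ (Z : Set K) ⊆ B ∧ B.FG ∧
      (∀ y ∈ (toricField F₁ x).toSubfield, ∃ a ∈ B, ∃ b ∈ B, y = a / b) ∧
      IsRegularLocalRing
        (Localization.AtPrime (Ideal.comap (Subring.inclusion hB) (IsLocalRing.maximalIdeal O))) := by
  classical
  have hB₀F' : ∀ y, y ∈ B₀ → y ∈ F₁ := fun y hy =>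
    (IntermediateField.mem_toSubfield _ _).mp (hB₀F hy)
  have hfrac' : ∀ y : K, y ∈ F₁ → ∃ a ∈ B₀, ∃ b ∈ B₀, b ≠ 0 ∧ y = a / b := by
    intro y hy
    rcases eq_or_ne y 0 with rfl | hy0
    · exact ⟨0, B₀.zero_mem, 1, B₀.one_mem, one_ne_zero, by simp⟩
    · obtain ⟨a, ha, b, hb, hab⟩ := hfrac y ((IntermediateField.mem_toSubfield _ _).mpr hy)
      refine ⟨a, ha, b, hb, ?_, hab⟩
      rintro rfl
      rw [div_zero] at hab
      exact hy0 hab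
  -- K1': integral representations of the elements of `Z`
  have hrep : ∀ z ∈ Z, ∃ P Q : MvPolynomial (Fin ρ) K, (∀ e, P.coeff e ∈ B₀) ∧
      (∀ e, Q.coeff e ∈ B₀) ∧ MvPolynomial.eval x Q ≠ 0 ∧
      z * MvPolynomial.eval x Q = MvPolynomial.eval x P := fun z hz =>
    exists_rep_integral F₁ B₀ hfrac' x (hZ z hz).2
  choose Pz Qz hPB hQB hQ0 hzeq using hrep
  -- the finite set of non-zero coefficients
  let W : Finset K := Z.attach.biUnion fun z =>
    (Pz z.1 z.2).support.image (Pz z.1 z.2).coeff ∪ (Qz z.1 z.2).support.image (Qz z.1 z.2).coeff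
  have hWP : ∀ z (hz : z ∈ Z), ∀ e ∈ (Pz z hz).support, (Pz z hz).coeff e ∈ W := by
    intro z hz e he
    exact Finset.mem_biUnion.mpr ⟨⟨z, hz⟩, Finset.mem_attach _ _,
      Finset.mem_union_left _ (Finset.mem_image.mpr ⟨e, he, rfl⟩)⟩
  have hWQ : ∀ z (hz : z ∈ Z), ∀ e ∈ (Qz z hz).support, (Qz z hz).coeff e ∈ W := by
    intro z hz e he
    exact Finset.mem_biUnion.mpr ⟨⟨z, hz⟩, Finset.mem_attach _ _,
      Finset.mem_union_right _ (Finset.mem_image.mpr ⟨e, he, rfl⟩)⟩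
  have hW : ∀ w ∈ W, w ∈ B₀ ∧ w ≠ 0 := by
    intro w hw
    obtain ⟨z, -, hw⟩ := Finset.mem_biUnion.mp hw
    rcases Finset.mem_union.mp hw with h | h
    · obtain ⟨e, he, rfl⟩ := Finset.mem_image.mp h
      exact ⟨hPB z.1 z.2 e, MvPolynomial.mem_support_iff.mp he⟩
    · obtain ⟨e, he, rfl⟩ := Finset.mem_image.mp h
      exact ⟨hQB z.1 z.2 e, MvPolynomial.mem_support_iff.mp he⟩
  -- the initial chart (CJS) and the upgrade to (V) (Perron–Zariski, Σ₁)
  obtain ⟨S, d, t, hd3, -, hS, ht, hmono⟩ :=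
    exists_initial_chart hCJS O F₁ htr B₀ hB₀O hB₀F' hB₀fg hfrac' hreg W hW
  obtain ⟨S₁, t₁, -, hS₁, ht₁, hmono₁, hV⟩ := valIndep_upgrade O hStep hk F₁ hd3 S t hS ht W hmono
  -- KK05 Thm. 4.1
  refine hAsc k K O hk F₁ S₁ hS₁ d t₁ ht₁ hV ρ x hx Z (fun z hz => (hZ z hz).1) fun z hz => ?_
  exact ⟨Pz z hz, Qz z hz, fun e he => hmono₁ _ (hWP z hz e he), fun e he => hmono₁ _ (hWQ z hz e he),
    hQ0 z hz, hzeq z hz⟩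

end Core

end PartV

end Summit.ResolutionOfSingularities.ResolutionOfSingularities.Theorems.PerronLadder
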